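import Summits.QuantumFields.BalabanUV.T4Continuum.Support.AbelianBlockAverage
import Summits.QuantumFields.BalabanUV.T4Continuum.Support.SmoothRefineNeutral
import Summits.QuantumFields.BalabanUV.T4Continuum.Support.MinimalActionClassSix
import Literature.Analysis.Complex.RungeUnits

/-!
# T⁴ programme, node NE3 — candidate row S3-D7 «A-H4-cur», ABELIAN SANITY FILE: Bałaban's block average (42)
# PRESERVES THE FLUX-LIPSCHITZ CONSTANT in a commutative coefficient algebra, hence the lattice current (1.9) of
# the averaged configuration obeys the SAME k-uniform bound `2(d−1)c` as a regular fine configuration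

NE3 formalisation swarm, leaf seat `b2b-balaban-t4-ne3-formalise-leaf-05` (gen 3), FIRST REFUSAL on the candidate row S3-D7
(typer ρ36 (v); SHAPE v0 `t4/formal/NE3/Statements/S3-D7-SHAPE-v0.md`).  CONTEXT.  DIVERGENCE D-s3-1: the tree's small-field
class `sfClass` is not B11's class (6), which also carries the CURRENT condition (1.9) of [Balaban1985RegularSpaces] —
one power of `η` finer than the plaquette condition (`MinimalActionClassSix`, leaf-04 g2).  Regular configurations
(`RegularSup`: plaquettes `bη²`, flux gradients `cη³`) lie in (6) k-uniformly (`mem_classSix_of_regularSup`, threshold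
`2(d−1)c < ε₀`); what the action sandwich still lacks for the class (6) AS PRINTED is the membership of its AVERAGED
competitor `rescale L (bavg L U)` — a transport of the current under (42) (the skeleton's risk (r3); in print nowhere as
such).  THIS FILE settles the ABELIAN case exactly, as the sanity check announced in the SHAPE (journal l.10877): for
`W = exp ∘ A` bondwise with values in a COMMUTATIVE complete normed algebra,

§1 `asum_shift` ∕ `Tside_shift` (translation covariance of the contour functionals); `coarseFlux_eq_avg_stokes`: the
   coarse plaquette exponent `T_{c₁} + T_{c₂} − T_{c₃} − T_{c₄}` of the averaged configuration IS the block AVERAGE of the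
   `L × L`-square fluxes, i.e. of DOUBLE SUMS of `L²` fine plaquette fluxes ([Balaban1985Averaging] (48) p. 25 = the
   tree's `corner_cancellation` + `stokes`, summed over the block with the weights `L^{−d}`);
§2 `norm_flux_shift_le` (a fine flux moved by `n` lattice steps changes by `≤ n·g` under the flux-Lipschitz bound `g`),
   **`norm_coarseFlux_shift_sub_le`**: the coarse exponent moved by ONE coarse step (= `L` fine steps) changes by
   `≤ L²·(L·g) = L³·g` — the flux-Lipschitz constant is PRESERVED in lattice units (`L³g = c·η_k³` when `g = c·η_{k+1}³`);
   `norm_coarseFlux_le` (`≤ L²·φ` from a fine flux bound `φ`);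
§3 the averaged configuration in closed form (`rescale_bavg_expUnit`, from leaf-03's `AbelianBlockAverage.bavg_expUnit`
   inside the ball of the logarithm), its coarse plaquette variables `plaqF = exp(coarse exponent)`
   (`plaqF_rescale_bavg_expUnit`), and **`covDiv_rescale_bavg_abelian_le`**: for every coarse bond,
   `‖B8Ineq132.covDiv η (rescale L (bavg L W)) μ z‖ ≤ |η|⁻¹·(d−1)·(L³g·e^{L²φ})` (exp-Lipschitz
   `Literature.Analysis.Complex.norm_exp_sub_exp_le`; plane count `MinimalActionClassSix.norm_covDiv_le` BY NAME);
§4 **`covDiv_rescale_bavg_abelian_le_scaled`**: at `η = (L^k)⁻¹`, `g = c/(L^{k+1})³`, `L²φ ≤ 1/2`: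
   `‖covDiv ((L^k)⁻¹) (rescale L (bavg L W)) μ z‖ ≤ 2(d−1)·c/(L^k)²` (`e^{1/2} ≤ 2`) — the SAME constant `2(d−1)c` that
   `MinimalActionClassSix.mem_classSix_of_regularSup` asks of a regular FINE configuration: in the abelian case block
   averaging costs NOTHING in the current condition (1.9).
What is NOT here: the non-abelian case (S3-D7 proper: the mismatch law `BlockAverageLoopLog.loopLog_of_regular` replaces
the exact closed form, at the price of second-order terms `O(b²η_{k+1})` — SHAPE v0 §2), minimisers, rates.

HONEST FRAMING.  Kinematics of (42) in a commutative algebra (finite-T⁴ rung (B)+1 bookkeeping); OURS and elementary;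
NOTHING about Bałaban's minimisers or NE3 is asserted; no conditional of the cell (`BetaPertH`, (B), G-an2-4) is used
or hidden; NE3 is NOT proved; spine PROVED 0∕9; NOT infinite volume, NOT a mass gap, NOT Clay, NOT summit progress.
ABSOLUTE RULE kept: no printed sentence is a hypothesis ([Balaban1985Averaging] (42), (47)–(48) p. 23–25 and
[Balaban1985RegularSpaces] (1.1)–(1.2), (1.9) pp. 76–77 enter only through the tree's definitions `bavg`, `Tside`,
`covDiv`); 0 `def`, 0 `sorry`.  PLACEMENT: `Summits/QuantumFields/BalabanUV/`; imports the accepted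
`Support.AbelianBlockAverage` (leaf-03), `Support.SmoothRefineNeutral` (leaf-10; `asum_sub`, `Tside_sub`),
`Support.MinimalActionClassSix` (leaf-04 g2; `norm_covDiv_le`, and through it `B8Ineq132`) and
`Literature.Analysis.Complex.RungeUnits` BY NAME; restates nothing.
-/

set_option autoImplicit false

open scoped BigOperators
open NormedSpace Finset

namespace Summit.QuantumFields.BalabanUV.T4Continuum.BlockAverageCurrentAbelian

open Literature.MathematicalPhysics.QuantumFieldTheory.Balaban1983to89
open B7Prop1Explicit B7Prop2Explicit
open B7Eq78Linearization (conjR conjR_apply)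
open B8Ineq132 (plaqF covDeriv covDiv)
open AbelianBlockAverage (hol_expUnit bavg_expUnit norm_asum_loop_le)
open SmoothRefineNeutral (asum_sub Tside_sub)
open MinimalActionClassSix (norm_covDiv_le)

noncomputable section

variable {d : ℕ}

/-! ## §1 Translation covariance and the coarse exponent as a block average of square fluxes -/

section Linear

variable {𝔸 : Type*} [NormedRing 𝔸] [NormedAlgebra ℂ 𝔸]

omit [NormedAlgebra ℂ 𝔸] in
/-- Translation covariance of the contour sum: `(τ_v A)(Γ from x) = A(Γ from x + v)`. [folklore] -/
theorem asum_shift (A : Site d → Fin d → 𝔸) (v : Site d) :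
    ∀ (x : Site d) (w : List (Letter d)), asum (fun y μ => A (y + v) μ) x w = asum A (x + v) w
  | x, [] => by simp
  | x, l :: w => by
    rw [asum_cons, asum_cons, asum_shift A v (x + l.vec) w, add_right_comm x l.vec v]
    congr 1
    obtain ⟨μ, b⟩ := l
    cases b <;> simp only [stepA, Bool.false_eq_true, ↓reduceIte, add_right_comm x _ v]

/-- Translation covariance of the contour average `T_c`. [folklore] -/
theorem Tside_shift (L : ℕ) (A : Site d → Fin d → 𝔸) (v q : Site d) (κ : Fin d) :
    Tside L (fun y μ => A (y + v) μ) q κ = Tside L A (q + v) κ := by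
  unfold Tside
  simp only [asum_shift]

/-- **THE COARSE EXPONENT IS THE BLOCK AVERAGE OF THE SQUARE FLUXES** ((48) p. 25: corner cancellation + abelian
Stokes, summed over the block): `T(q,μ) + T(q + Le_μ, ν) − T(q + Le_ν, μ) − T(q, ν)
= Σ_r L^{−d} · Σ_{i,j<L} A(∂p(q + x_r + i e_μ + j e_ν; μ, ν))`. [folklore] -/
theorem coarseFlux_eq_avg_stokes (L : ℕ) (A : Site d → Fin d → 𝔸) (q : Site d) (μ ν : Fin d) :
    Tside L A q μ + Tside L A (q + (L : ℤ) • e μ) ν - Tside L A (q + (L : ℤ) • e ν) μ - Tside L A q ν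
      = ∑ r : Fin d → Fin L, ((L : ℝ) ^ d)⁻¹ •
          ∑ i ∈ Finset.range L, ∑ j ∈ Finset.range L,
            asum A (q + boxVec L r + (i : ℤ) • e μ + (j : ℤ) • e ν) (plaqWord μ ν) := by
  have h : Tside L A q μ + Tside L A (q + (L : ℤ) • e μ) ν - Tside L A (q + (L : ℤ) • e ν) μ - Tside L A q ν
      = ∑ r : Fin d → Fin L, ((L : ℝ) ^ d)⁻¹ • asum A (q + boxVec L r) (rectWord L L μ ν) := by
    simp only [Tside, ← Finset.sum_sub_distrib, ← Finset.sum_add_distrib, ← smul_sub, ← smul_add]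
    refine Finset.sum_congr rfl fun r _ => ?_
    rw [corner_cancellation]
  rw [h]
  refine Finset.sum_congr rfl fun r _ => ?_
  rw [stokes]

end Linear

/-! ## §2 Flux-Lipschitz bounds survive averaging with the same constant (in lattice units) -/

section Bounds

variable {𝔸 : Type*} [NormedRing 𝔸] [NormedAlgebra ℂ 𝔸]

omit [NormedAlgebra ℂ 𝔸] in
/-- A fine flux moved by `n` steps in direction `e_λ` changes by at most `n·g` under the flux-Lipschitz bound `g`.
[folklore] -/
theorem norm_flux_shift_le (A : Site d → Fin d → 𝔸) {g : ℝ}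
    (hg : ∀ (x : Site d) (lam μ ν : Fin d), ‖asum A (x + e lam) (plaqWord μ ν) - asum A x (plaqWord μ ν)‖ ≤ g)
    (x : Site d) (lam μ ν : Fin d) :
    ∀ n : ℕ, ‖asum A (x + (n : ℤ) • e lam) (plaqWord μ ν) - asum A x (plaqWord μ ν)‖ ≤ n * g
  | 0 => by simp
  | n + 1 => by
    have ih := norm_flux_shift_le A hg x lam μ ν n
    have hstep := hg (x + (n : ℤ) • e lam) lam μ ν
    have e1 : x + ((n + 1 : ℕ) : ℤ) • e lam = x + (n : ℤ) • e lam + e lam := by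
      simp only [Nat.cast_succ, add_smul, one_smul, add_assoc]
    rw [e1]
    calc ‖asum A (x + (n : ℤ) • e lam + e lam) (plaqWord μ ν) - asum A x (plaqWord μ ν)‖
        = ‖(asum A (x + (n : ℤ) • e lam + e lam) (plaqWord μ ν) - asum A (x + (n : ℤ) • e lam) (plaqWord μ ν))
            + (asum A (x + (n : ℤ) • e lam) (plaqWord μ ν) - asum A x (plaqWord μ ν))‖ := by rw [sub_add_sub_cancel]
      _ ≤ g + n * g := (norm_add_le _ _).trans (add_le_add hstep ih)
      _ = ((n + 1 : ℕ) : ℝ) * g := by push_cast; ring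

/-- **THE COARSE EXPONENT MOVED BY ONE COARSE STEP** (`= L` fine steps in direction `e_λ`) changes by at most `L³·g`:
the block average of `L²` fine fluxes, each moved by `L` steps.  With `g = c·η′³` (`η′ = η/L` the fine spacing)
this is `c·η³`: the flux-Lipschitz constant `c` is PRESERVED by the abelian average. [folklore] -/
theorem norm_coarseFlux_shift_sub_le {L : ℕ} (hL : 1 ≤ L) (A : Site d → Fin d → 𝔸) {g : ℝ}
    (hg : ∀ (x : Site d) (lam μ ν : Fin d), ‖asum A (x + e lam) (plaqWord μ ν) - asum A x (plaqWord μ ν)‖ ≤ g)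
    (q : Site d) (lam μ ν : Fin d) :
    ‖(Tside L A (q + (L : ℤ) • e lam) μ + Tside L A (q + (L : ℤ) • e lam + (L : ℤ) • e μ) ν
          - Tside L A (q + (L : ℤ) • e lam + (L : ℤ) • e ν) μ - Tside L A (q + (L : ℤ) • e lam) ν)
        - (Tside L A q μ + Tside L A (q + (L : ℤ) • e μ) ν - Tside L A (q + (L : ℤ) • e ν) μ - Tside L A q ν)‖
      ≤ (L : ℝ) ^ 3 * g := by
  rw [coarseFlux_eq_avg_stokes, coarseFlux_eq_avg_stokes, ← Finset.sum_sub_distrib]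
  simp only [← smul_sub]
  refine norm_avg_le L hL _ fun r => ?_
  rw [← Finset.sum_sub_distrib]
  have hL2 : ∀ i ∈ Finset.range L, ‖∑ j ∈ Finset.range L,
      asum A (q + (L : ℤ) • e lam + boxVec L r + (i : ℤ) • e μ + (j : ℤ) • e ν) (plaqWord μ ν)
      - ∑ j ∈ Finset.range L, asum A (q + boxVec L r + (i : ℤ) • e μ + (j : ℤ) • e ν) (plaqWord μ ν)‖
      ≤ L * ((L : ℝ) * g) := by
    intro i _
    rw [← Finset.sum_sub_distrib]
    refine (norm_sum_le _ _).trans ?_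
    have hterm : ∀ j ∈ Finset.range L,
        ‖asum A (q + (L : ℤ) • e lam + boxVec L r + (i : ℤ) • e μ + (j : ℤ) • e ν) (plaqWord μ ν)
          - asum A (q + boxVec L r + (i : ℤ) • e μ + (j : ℤ) • e ν) (plaqWord μ ν)‖ ≤ (L : ℝ) * g := by
      intro j _
      have h := norm_flux_shift_le A hg (q + boxVec L r + (i : ℤ) • e μ + (j : ℤ) • e ν) lam μ ν L
      rwa [show q + boxVec L r + (i : ℤ) • e μ + (j : ℤ) • e ν + (L : ℤ) • e lam
          = q + (L : ℤ) • e lam + boxVec L r + (i : ℤ) • e μ + (j : ℤ) • e ν by abel] at h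
    calc ∑ j ∈ Finset.range L, ‖asum A (q + (L : ℤ) • e lam + boxVec L r + (i : ℤ) • e μ + (j : ℤ) • e ν) (plaqWord μ ν)
            - asum A (q + boxVec L r + (i : ℤ) • e μ + (j : ℤ) • e ν) (plaqWord μ ν)‖
        ≤ ∑ _j ∈ Finset.range L, (L : ℝ) * g := Finset.sum_le_sum hterm
      _ = L * ((L : ℝ) * g) := by rw [Finset.sum_const, Finset.card_range, nsmul_eq_mul]
  calc ‖∑ i ∈ Finset.range L, (∑ j ∈ Finset.range L,
          asum A (q + (L : ℤ) • e lam + boxVec L r + (i : ℤ) • e μ + (j : ℤ) • e ν) (plaqWord μ ν)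
          - ∑ j ∈ Finset.range L, asum A (q + boxVec L r + (i : ℤ) • e μ + (j : ℤ) • e ν) (plaqWord μ ν))‖
      ≤ ∑ i ∈ Finset.range L, ‖∑ j ∈ Finset.range L,
          asum A (q + (L : ℤ) • e lam + boxVec L r + (i : ℤ) • e μ + (j : ℤ) • e ν) (plaqWord μ ν)
          - ∑ j ∈ Finset.range L, asum A (q + boxVec L r + (i : ℤ) • e μ + (j : ℤ) • e ν) (plaqWord μ ν)‖ :=
        norm_sum_le _ _
    _ ≤ ∑ _i ∈ Finset.range L, L * ((L : ℝ) * g) := Finset.sum_le_sum hL2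
    _ = (L : ℝ) ^ 3 * g := by rw [Finset.sum_const, Finset.card_range, nsmul_eq_mul]; ring

/-- SIZE OF THE COARSE EXPONENT: `≤ L²·φ` from a fine flux bound `φ` (an average of `L²` fluxes). [folklore] -/
theorem norm_coarseFlux_le {L : ℕ} (hL : 1 ≤ L) (A : Site d → Fin d → 𝔸) {φ : ℝ}
    (hφ : ∀ (x : Site d) (μ ν : Fin d), ‖asum A x (plaqWord μ ν)‖ ≤ φ) (q : Site d) (μ ν : Fin d) :
    ‖Tside L A q μ + Tside L A (q + (L : ℤ) • e μ) ν - Tside L A (q + (L : ℤ) • e ν) μ - Tside L A q ν‖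
      ≤ (L : ℝ) ^ 2 * φ := by
  rw [coarseFlux_eq_avg_stokes]
  refine norm_avg_le L hL _ fun r => ?_
  calc ‖∑ i ∈ Finset.range L, ∑ j ∈ Finset.range L,
          asum A (q + boxVec L r + (i : ℤ) • e μ + (j : ℤ) • e ν) (plaqWord μ ν)‖
      ≤ ∑ i ∈ Finset.range L, ‖∑ j ∈ Finset.range L,
          asum A (q + boxVec L r + (i : ℤ) • e μ + (j : ℤ) • e ν) (plaqWord μ ν)‖ := norm_sum_le _ _
    _ ≤ ∑ _i ∈ Finset.range L, (L : ℝ) * φ := by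
        refine Finset.sum_le_sum fun i _ => (norm_sum_le _ _).trans ?_
        calc ∑ j ∈ Finset.range L, ‖asum A (q + boxVec L r + (i : ℤ) • e μ + (j : ℤ) • e ν) (plaqWord μ ν)‖
            ≤ ∑ _j ∈ Finset.range L, φ := Finset.sum_le_sum fun j _ => hφ _ μ ν
          _ = (L : ℝ) * φ := by rw [Finset.sum_const, Finset.card_range, nsmul_eq_mul]
    _ = (L : ℝ) ^ 2 * φ := by rw [Finset.sum_const, Finset.card_range, nsmul_eq_mul]; ring

end Bounds

/-! ## §3 The averaged configuration in closed form and its current -/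

section Comm

variable {𝔸 : Type*} [NormedCommRing 𝔸] [NormOneClass 𝔸] [NormedAlgebra ℂ 𝔸] [CompleteSpace 𝔸]

omit [NormOneClass 𝔸] [NormedAlgebra ℂ 𝔸] [CompleteSpace 𝔸] in
/-- In a commutative algebra `R(u)X = X`. [folklore] -/
theorem conjR_eq_self (u : 𝔸ˣ) (X : 𝔸) : conjR u X = X := by
  rw [conjR_apply, mul_comm (u : 𝔸) X, mul_assoc, Units.mul_inv, mul_one]

omit [NormOneClass 𝔸] in
/-- **THE RESCALED ABELIAN AVERAGE IN CLOSED FORM**: inside the ball of the logarithm,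
`rescale L (bavg L (exp ∘ A)) = exp ∘ Ā` with the coarse potential `Ā(z, κ) := T_{⟨Lz, Lz + Le_κ⟩}(A)`
(leaf-03's `bavg_expUnit` at every coarse bond). [folklore] -/
theorem rescale_bavg_expUnit {L : ℕ} (hL : 1 ≤ L) (A : Site d → Fin d → 𝔸)
    (hlog : ∀ (q : Site d) (κ : Fin d) (r : Fin d → Fin L),
      ‖asum A q (gammaWord L κ (boxVec L r) ++ seg κ (-(L : ℤ)))‖ < Real.log 2) :
    rescale L (bavg L (fun y μ => expUnit (A y μ)))
      = fun z κ => expUnit (Tside L A ((L : ℤ) • z) κ) := by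
  funext z κ
  rw [rescale_apply, bavg_expUnit L hL A _ κ (hlog _ κ)]

omit [NormOneClass 𝔸] in
/-- **THE COARSE PLAQUETTE VARIABLES OF THE ABELIAN AVERAGE**: `(∂W̄)(p_{μν}(z)) = exp(T(Lz,μ) + T(Lz + Le_μ, ν) −
T(Lz + Le_ν, μ) − T(Lz, ν))` (abelian transport `hol_expUnit` along the plaquette word). [folklore] -/
theorem plaqF_rescale_bavg_expUnit {L : ℕ} (hL : 1 ≤ L) (A : Site d → Fin d → 𝔸)
    (hlog : ∀ (q : Site d) (κ : Fin d) (r : Fin d → Fin L),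
      ‖asum A q (gammaWord L κ (boxVec L r) ++ seg κ (-(L : ℤ)))‖ < Real.log 2) (μ ν : Fin d) (z : Site d) :
    plaqF (rescale L (bavg L (fun y μ => expUnit (A y μ)))) μ ν z
      = exp (Tside L A ((L : ℤ) • z) μ + Tside L A ((L : ℤ) • z + (L : ℤ) • e μ) ν
          - Tside L A ((L : ℤ) • z + (L : ℤ) • e ν) μ - Tside L A ((L : ℤ) • z) ν) := by
  unfold plaqF
  rw [rescale_bavg_expUnit hL A hlog, hol_expUnit, val_expUnit, asum_plaqWord]
  simp only [smul_add]

/-- **THE CURRENT OF THE ABELIAN AVERAGE**: for `W = exp ∘ A` (values in a commutative complete normed algebra, inside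
the ball of the logarithm of (42)) with fine fluxes `≤ φ` and flux-Lipschitz constant `g`, every coarse bond satisfies
`‖(D^{η*}_{W̄} ∂W̄)(z, z + e_μ)‖ ≤ |η|⁻¹·(d−1)·(L³g·e^{L²φ})` for the rescaled average `W̄ = rescale L (bavg L W)`.
[folklore] -/
theorem covDiv_rescale_bavg_abelian_le {L : ℕ} (hL : 1 ≤ L) (A : Site d → Fin d → 𝔸)
    (hlog : ∀ (q : Site d) (κ : Fin d) (r : Fin d → Fin L),
      ‖asum A q (gammaWord L κ (boxVec L r) ++ seg κ (-(L : ℤ)))‖ < Real.log 2)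
    {φ g : ℝ} (hg0 : 0 ≤ g) (hφ : ∀ (x : Site d) (μ ν : Fin d), ‖asum A x (plaqWord μ ν)‖ ≤ φ)
    (hg : ∀ (x : Site d) (lam μ ν : Fin d), ‖asum A (x + e lam) (plaqWord μ ν) - asum A x (plaqWord μ ν)‖ ≤ g)
    (η : ℝ) (μ : Fin d) (z : Site d) :
    ‖covDiv η (rescale L (bavg L (fun y μ => expUnit (A y μ)))) μ z‖
      ≤ |η|⁻¹ * (((d : ℝ) - 1) * ((L : ℝ) ^ 3 * g * Real.exp ((L : ℝ) ^ 2 * φ))) := by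
  -- one transported difference, any plane `(α, β)` and any direction `ν`
  have key : ∀ (α β ν : Fin d),
      ‖conjR (rescale L (bavg L (fun y μ => expUnit (A y μ))) (z - e ν) ν)⁻¹
          (plaqF (rescale L (bavg L (fun y μ => expUnit (A y μ)))) α β (z - e ν))
        - plaqF (rescale L (bavg L (fun y μ => expUnit (A y μ)))) α β z‖
        ≤ (L : ℝ) ^ 3 * g * Real.exp ((L : ℝ) ^ 2 * φ) := by
    intro α β ν
    rw [conjR_eq_self, plaqF_rescale_bavg_expUnit hL A hlog, plaqF_rescale_bavg_expUnit hL A hlog, ← norm_neg, neg_sub]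
    set q : Site d := (L : ℤ) • (z - e ν) with hq
    have hz : (L : ℤ) • z = q + (L : ℤ) • e ν := by rw [hq, smul_sub, sub_add_cancel]
    rw [hz]
    refine (Literature.Analysis.Complex.norm_exp_sub_exp_le _ _).trans ?_
    have h1 := norm_coarseFlux_shift_sub_le hL A hg q ν α β
    have h2 := norm_coarseFlux_le hL A hφ (q + (L : ℤ) • e ν) α β
    have h3 := norm_coarseFlux_le hL A hφ q α β
    have hmax : Real.exp (max ‖Tside L A (q + (L : ℤ) • e ν) α + Tside L A (q + (L : ℤ) • e ν + (L : ℤ) • e α) β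
          - Tside L A (q + (L : ℤ) • e ν + (L : ℤ) • e β) α - Tside L A (q + (L : ℤ) • e ν) β‖
        ‖Tside L A q α + Tside L A (q + (L : ℤ) • e α) β - Tside L A (q + (L : ℤ) • e β) α - Tside L A q β‖)
        ≤ Real.exp ((L : ℝ) ^ 2 * φ) := Real.exp_le_exp.mpr (max_le h2 h3)
    exact mul_le_mul h1 hmax (Real.exp_nonneg _) (by positivity)
  exact norm_covDiv_le η _ μ z (fun ν _ => key ν μ ν) (fun ν _ => key μ ν ν)

omit [NormOneClass 𝔸] [NormedAlgebra ℂ 𝔸] [CompleteSpace 𝔸] in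
/-- A global bond bound `‖A_b‖ ≤ a` with `(2dL + 2L)·a < log 2` puts every loop of (42) inside the ball of the logarithm
(leaf-03's `norm_asum_loop_le`). [folklore] -/
theorem loops_small_of_bond_bound {L : ℕ} (A : Site d → Fin d → 𝔸) {a : ℝ} (ha : 0 ≤ a)
    (hA : ∀ (y : Site d) (μ : Fin d), ‖A y μ‖ ≤ a) (hsmall : ((2 * (d * L) + L + L : ℕ) : ℝ) * a < Real.log 2)
    (q : Site d) (κ : Fin d) (r : Fin d → Fin L) :
    ‖asum A q (gammaWord L κ (boxVec L r) ++ seg κ (-(L : ℤ)))‖ < Real.log 2 :=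
  (norm_asum_loop_le L A q κ ha (fun x μ _ => hA x μ) r).trans_lt hsmall

/-! ## §4 The scaled statement: the SAME constant `2(d−1)c` as for a regular fine configuration -/

/-- **ABELIAN A-H4-cur, SCALED** (`η = (L^k)⁻¹` the coarse spacing, `g = c/(L^{k+1})³` the fine flux-Lipschitz bound in
lattice units, `L²φ ≤ 1/2`): `‖covDiv ((L^k)⁻¹) (rescale L (bavg L W)) μ z‖ ≤ 2(d−1)·c/(L^k)²` — EXACTLY the current
bound `mem_classSix_of_regularSup` extracts from a fine `RegularSup … c` configuration: in the abelian case the averaged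
competitor meets B11's current condition (1.9) under the SAME k-uniform threshold `2(d−1)c < ε₀`. [folklore] -/
theorem covDiv_rescale_bavg_abelian_le_scaled {L : ℕ} (hL : 1 ≤ L) (A : Site d → Fin d → 𝔸)
    (hlog : ∀ (q : Site d) (κ : Fin d) (r : Fin d → Fin L),
      ‖asum A q (gammaWord L κ (boxVec L r) ++ seg κ (-(L : ℤ)))‖ < Real.log 2)
    {φ c : ℝ} {k : ℕ} (hc : 0 ≤ c) (hφ2 : (L : ℝ) ^ 2 * φ ≤ 1 / 2)
    (hφ : ∀ (x : Site d) (μ ν : Fin d), ‖asum A x (plaqWord μ ν)‖ ≤ φ)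
    (hg : ∀ (x : Site d) (lam μ ν : Fin d),
      ‖asum A (x + e lam) (plaqWord μ ν) - asum A x (plaqWord μ ν)‖ ≤ c / ((L : ℝ) ^ (k + 1)) ^ 3)
    (μ : Fin d) (z : Site d) :
    ‖covDiv (((L : ℝ) ^ k)⁻¹) (rescale L (bavg L (fun y μ => expUnit (A y μ)))) μ z‖
      ≤ 2 * ((d : ℝ) - 1) * c / ((L : ℝ) ^ k) ^ 2 := by
  have hL1 : (1 : ℝ) ≤ L := by exact_mod_cast hL
  have hL0 : (0 : ℝ) < L := by linarith
  have hLk : (0 : ℝ) < (L : ℝ) ^ k := by positivity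
  have hg0 : 0 ≤ c / ((L : ℝ) ^ (k + 1)) ^ 3 := by positivity
  have h := covDiv_rescale_bavg_abelian_le hL A hlog hg0 hφ hg (((L : ℝ) ^ k)⁻¹) μ z
  rw [abs_of_pos (inv_pos.mpr hLk), inv_inv] at h
  have hd : (0 : ℝ) ≤ (d : ℝ) - 1 := by
    have : 1 ≤ d := μ.pos
    have : (1 : ℝ) ≤ d := by exact_mod_cast this
    linarith
  have hexp2 : Real.exp (1 / 2) ≤ 2 := by
    have h3 : Real.exp (1 / 2) * Real.exp (1 / 2) = Real.exp 1 := by rw [← Real.exp_add]; norm_num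
    nlinarith [Real.exp_pos (1 / 2 : ℝ), Real.exp_one_lt_d9]
  have hexp : Real.exp ((L : ℝ) ^ 2 * φ) ≤ 2 := (Real.exp_le_exp.mpr hφ2).trans hexp2
  have hscale : (L : ℝ) ^ k * (((d : ℝ) - 1) * ((L : ℝ) ^ 3 * (c / ((L : ℝ) ^ (k + 1)) ^ 3) * Real.exp ((L : ℝ) ^ 2 * φ)))
      ≤ 2 * ((d : ℝ) - 1) * c / ((L : ℝ) ^ k) ^ 2 := by
    have e1 : (L : ℝ) ^ k * (((d : ℝ) - 1) * ((L : ℝ) ^ 3 * (c / ((L : ℝ) ^ (k + 1)) ^ 3) * 2))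
        = 2 * ((d : ℝ) - 1) * c / ((L : ℝ) ^ k) ^ 2 := by
      field_simp
      ring
    rw [← e1]
    have hnn : 0 ≤ (L : ℝ) ^ k * (((d : ℝ) - 1) * ((L : ℝ) ^ 3 * (c / ((L : ℝ) ^ (k + 1)) ^ 3))) := by positivity
    calc (L : ℝ) ^ k * (((d : ℝ) - 1) * ((L : ℝ) ^ 3 * (c / ((L : ℝ) ^ (k + 1)) ^ 3) * Real.exp ((L : ℝ) ^ 2 * φ)))
        = (L : ℝ) ^ k * (((d : ℝ) - 1) * ((L : ℝ) ^ 3 * (c / ((L : ℝ) ^ (k + 1)) ^ 3))) * Real.exp ((L : ℝ) ^ 2 * φ) := by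
          ring
      _ ≤ (L : ℝ) ^ k * (((d : ℝ) - 1) * ((L : ℝ) ^ 3 * (c / ((L : ℝ) ^ (k + 1)) ^ 3))) * 2 :=
          mul_le_mul_of_nonneg_left hexp hnn
      _ = (L : ℝ) ^ k * (((d : ℝ) - 1) * ((L : ℝ) ^ 3 * (c / ((L : ℝ) ^ (k + 1)) ^ 3) * 2)) := by ring
  exact h.trans hscale

end Comm

end

end Summit.QuantumFields.BalabanUV.T4Continuum.BlockAverageCurrentAbelian
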